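import Mathlib
import Literature.Analysis.FluidPDE.NewtonPotentialHolder
import Literature.Analysis.FluidPDE.LeraySeparationOfEnergyTools
import Summits.NavierStokesRegularity.NavierStokesRegularity.Theorems.EulerZoomLiouvillePowerGaugeEulerLiouvilleSelfSimilarGradient
import Summits.NavierStokesRegularity.NavierStokesRegularity.Theorems.EulerZoomLiouvillePowerGaugeEulerLiouvilleSelfSimilarPastProfileGradient

/-!
# Weighted dissipation integral of the profile of a member exact up to its blow-up time

Sub-problem `NavierStokesRegularity`, crux `PowerGaugeEulerLiouville` (a crux CLASS of self-similar Euler/NS strata — not NS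
regularity).  A class member exactly self-similar about `(T, x₀)` for all `τ < T` (`T ≤ 0`): the `E`-gauge at ONE scale bounds
`∫_{‖y‖ ≥ r₋} |G|²_F ‖y‖^{ρ−1}` (translate by `(T, x₀)`, then the single-window Tonelli computation of
`profile_gradient_weight_of_gaugeE`), so a `C¹` profile has `∫⁻ ‖DV‖ₑ² ‖y‖^{ρ−1} < ∞` — the input `hEw` of
`Condenser.selfSimilar_ae_eq_zero_of_finiteTypeGradientC2_past_of_weight`.  For members exact only for `τ < T₁ < T` one cylinder
sees a bounded window of profile radii and the weighted integral is NOT a consequence of the gauges.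
-/

noncomputable section

set_option linter.dupNamespace false

open MeasureTheory Set Filter Topology Metric Function TopologicalSpace
open scoped ENNReal NNReal InnerProductSpace RealInnerProductSpace

namespace Summit.NavierStokesRegularity.NavierStokesRegularity.Theorems.PowerGaugeEulerLiouville

open Literature.Analysis Literature.Analysis.FunctionSpaces Literature.Analysis.FluidPDE

namespace Past

/-- **Centred single-window bound (a.e. hypotheses).**  `Ht` a.e.-strongly measurable on the window `(−Λ,0) × B_a` with
`Ht τ = (−τ)^{−1} • G((−τ)^{−γ} •)` a.e. on `ℝ³` for a.e. `τ ∈ (−Λ, 0)` (`γ = 1/(2+ρ)`, `0 < ρ < 1`):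
`(a^{1−ρ}(2+ρ)/(1−ρ)) · ∫_{‖y‖ ≥ aΛ^{−γ}} |G|²_F ‖y‖^{ρ−1} ≤ ∫∫_{(−Λ,0)×B_a} |Ht|²_F` (STEP 1 of
`profile_gradient_weight_of_gaugeE`, window height `Λ` decoupled from the radius `a`). [folklore] -/
theorem lintegral_weight_region_le_cylinder {ρ : ℝ} (hρ : 0 < ρ) (hρ1 : ρ < 1) {Λ a : ℝ} (hΛ : 0 < Λ) (ha : 0 < a)
    {Ht : ℝ → EuclideanSpace ℝ (Fin 3) → EuclideanSpace ℝ (Fin 3) →L[ℝ] EuclideanSpace ℝ (Fin 3)}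
    {G : EuclideanSpace ℝ (Fin 3) → EuclideanSpace ℝ (Fin 3) →L[ℝ] EuclideanSpace ℝ (Fin 3)}
    (hGm : AEStronglyMeasurable G volume)
    (hHm : AEStronglyMeasurable (uncurry Ht)
      (volume.restrict (Ioo (-Λ) 0 ×ˢ ball (0 : EuclideanSpace ℝ (Fin 3)) a)))
    (hH : ∀ᵐ τ ∂((volume : Measure ℝ).restrict (Ioo (-Λ) 0)),
      Ht τ =ᵐ[volume] fun x => (-τ) ^ (-1 : ℝ) • G ((-τ) ^ (-(1 / (2 + ρ))) • x)) :
    ENNReal.ofReal (a ^ (1 - ρ) / ((1 - ρ) / (2 + ρ))) *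
        ∫⁻ y in {y : EuclideanSpace ℝ (Fin 3) | a * Λ ^ (-(1 / (2 + ρ))) ≤ ‖y‖},
          ENNReal.ofReal (frobeniusNormSq (G y)) * ENNReal.ofReal (‖y‖ ^ (ρ - 1)) ≤
      ∫⁻ q in Ioo (-Λ) 0 ×ˢ ball (0 : EuclideanSpace ℝ (Fin 3)) a,
        ENNReal.ofReal (frobeniusNormSq (Ht q.1 q.2)) := by
  -- adapted from `profile_gradient_weight_of_gaugeE` (…SelfSimilarGradient), STEP 1
  set γ : ℝ := 1 / (2 + ρ) with hγ
  have h2ρ : 0 < 2 + ρ := by linarith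
  have hγρ : γ * (2 + ρ) = 1 := by rw [hγ]; field_simp
  have hγ0 : 0 < γ := by rw [hγ]; positivity
  set κ : ℝ := 3 * γ - 1 with hκdef
  have hκ : κ = (1 - ρ) / (2 + ρ) := by
    rw [hκdef, hγ]; field_simp; ring
  have hκ0 : 0 < κ := by rw [hκ]; exact div_pos (by linarith) h2ρ
  have hq : -1 < 3 * γ - 2 := by linarith
  have hfm : Measurable fun L : EuclideanSpace ℝ (Fin 3) →L[ℝ] EuclideanSpace ℝ (Fin 3) =>
      ENNReal.ofReal (frobeniusNormSq L) :=
    (SereginZajaczkowski2007.continuous_frobeniusNormSq).measurable.ennreal_ofReal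
  rw [← hκ]
  set w : EuclideanSpace ℝ (Fin 3) → ℝ≥0∞ :=
    fun y => ENNReal.ofReal (frobeniusNormSq (G y)) * ENNReal.ofReal (‖y‖ ^ (ρ - 1)) with hw
  set X : ℝ≥0∞ := ∫⁻ q in Ioo (-Λ) 0 ×ˢ ball (0 : EuclideanSpace ℝ (Fin 3)) a,
    ENNReal.ofReal (frobeniusNormSq (Ht q.1 q.2)) with hX
  -- (1b) Tonelli on `(−Λ, 0) × B_a` and the slice scaling
  have hHmQ : AEMeasurable (fun q : ℝ × EuclideanSpace ℝ (Fin 3) =>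
      ENNReal.ofReal (frobeniusNormSq (Ht q.1 q.2)))
      (((volume : Measure ℝ).restrict (Ioo (-Λ) 0)).prod
        ((volume : Measure (EuclideanSpace ℝ (Fin 3))).restrict (ball 0 a))) := by
    have := hfm.comp_aemeasurable hHm.aemeasurable
    rw [Measure.volume_eq_prod, ← Measure.prod_restrict] at this
    exact this
  have hXeq : X = ∫⁻ τ in Ioo (-Λ) 0, ENNReal.ofReal ((-τ) ^ (3 * γ - 2)) *
      ∫⁻ y in ball (0 : EuclideanSpace ℝ (Fin 3)) ((-τ) ^ (-γ) * a),
        ENNReal.ofReal (frobeniusNormSq (G y)) := by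
    rw [hX, Measure.volume_eq_prod, ← Measure.prod_restrict, lintegral_prod _ hHmQ]
    refine lintegral_congr_ae ?_
    filter_upwards [hH, ae_restrict_mem measurableSet_Ioo] with τ hτ hτm
    rw [← lintegral_ball_frobeniusNormSq_selfSimilarGradient γ hτm.2 G a]
    refine lintegral_congr_ae (ae_restrict_of_ae ?_)
    filter_upwards [hτ] with x hx
    simp only [hx]
  -- (1c) swap the integrals
  set g : ℝ → EuclideanSpace ℝ (Fin 3) → ℝ≥0∞ := fun τ y =>
    ENNReal.ofReal ((-τ) ^ (3 * γ - 2)) *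
      {z : ℝ × EuclideanSpace ℝ (Fin 3) | ‖z.2‖ < (-z.1) ^ (-γ) * a}.indicator
        (fun z => ENNReal.ofReal (frobeniusNormSq (G z.2))) (τ, y) with hg
  have hS : MeasurableSet {z : ℝ × EuclideanSpace ℝ (Fin 3) | ‖z.2‖ < (-z.1) ^ (-γ) * a} :=
    measurableSet_lt measurable_snd.norm ((measurable_fst.neg.pow_const _).mul_const a)
  have hgm : AEMeasurable (uncurry g)
      (((volume : Measure ℝ).restrict (Ioo (-Λ) 0)).prod
        (volume : Measure (EuclideanSpace ℝ (Fin 3)))) := by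
    have h1 : Measurable fun z : ℝ × EuclideanSpace ℝ (Fin 3) => ENNReal.ofReal ((-z.1) ^ (3 * γ - 2)) :=
      (measurable_fst.neg.pow_const _).ennreal_ofReal
    have h2 : AEMeasurable (fun z : ℝ × EuclideanSpace ℝ (Fin 3) => ENNReal.ofReal (frobeniusNormSq (G z.2)))
        (((volume : Measure ℝ).restrict (Ioo (-Λ) 0)).prod
          (volume : Measure (EuclideanSpace ℝ (Fin 3)))) :=
      (hfm.comp_aemeasurable hGm.aemeasurable).comp_snd
    exact h1.aemeasurable.mul (h2.indicator hS)
  have hinner : ∀ τ : ℝ, τ ∈ Ioo (-Λ) 0 →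
      ENNReal.ofReal ((-τ) ^ (3 * γ - 2)) *
        ∫⁻ y in ball (0 : EuclideanSpace ℝ (Fin 3)) ((-τ) ^ (-γ) * a),
          ENNReal.ofReal (frobeniusNormSq (G y)) =
      ∫⁻ y, g τ y := by
    intro τ hτ
    rw [hg, lintegral_const_mul' _ _ ENNReal.ofReal_ne_top, ← lintegral_indicator measurableSet_ball]
    congr 1
    refine lintegral_congr fun y => ?_
    simp only [indicator, mem_ball, dist_zero_right, mem_setOf_eq]
  have hXswap : X = ∫⁻ y, ∫⁻ τ in Ioo (-Λ) 0, g τ y := by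
    rw [hXeq, setLIntegral_congr_fun measurableSet_Ioo hinner, lintegral_lintegral_swap hgm]
  -- (1d) lower bound for the time integral over a profile point `y` with `‖y‖ ≥ a Λ^{−γ}`
  have hlow : ∀ y : EuclideanSpace ℝ (Fin 3), a * Λ ^ (-γ) ≤ ‖y‖ →
      ENNReal.ofReal (a ^ (1 - ρ) / κ) * w y ≤ ∫⁻ τ in Ioo (-Λ) 0, g τ y := by
    intro y hy
    have hth : 0 < a * Λ ^ (-γ) := mul_pos ha (Real.rpow_pos_of_pos hΛ _)
    have hy0 : 0 < ‖y‖ := lt_of_lt_of_le hth hy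
    set m : ℝ := (a / ‖y‖) ^ (2 + ρ) with hm
    have hm0 : 0 < m := Real.rpow_pos_of_pos (div_pos ha hy0) _
    have hma : m ≤ Λ := by
      have h1 : a / ‖y‖ ≤ Λ ^ γ := by
        rw [div_le_iff₀ hy0]
        calc a = Λ ^ γ * (a * Λ ^ (-γ)) := by
              rw [mul_left_comm, ← Real.rpow_add hΛ, add_neg_cancel, Real.rpow_zero, mul_one]
          _ ≤ Λ ^ γ * ‖y‖ := mul_le_mul_of_nonneg_left hy (Real.rpow_nonneg hΛ.le _)
      calc m = (a / ‖y‖) ^ (2 + ρ) := hm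
        _ ≤ (Λ ^ γ) ^ (2 + ρ) := Real.rpow_le_rpow (div_pos ha hy0).le h1 h2ρ.le
        _ = Λ := by rw [← Real.rpow_mul hΛ.le, hγρ, Real.rpow_one]
    have hind : ∀ τ : ℝ, τ ∈ Ioo (-m) 0 → g τ y =
        ENNReal.ofReal ((-τ) ^ (3 * γ - 2)) * ENNReal.ofReal (frobeniusNormSq (G y)) := by
      intro τ hτ
      have hs : 0 < -τ := neg_pos.2 hτ.2
      have hlt : ‖y‖ < (-τ) ^ (-γ) * a := by
        have h1 : (-τ) ^ γ < a / ‖y‖ := by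
          have h2 : (-τ) ^ γ < m ^ γ := Real.rpow_lt_rpow hs.le (by linarith [hτ.1]) hγ0
          rw [hm, ← Real.rpow_mul (div_pos ha hy0).le, show (2 + ρ) * γ = 1 by
            linear_combination hγρ, Real.rpow_one] at h2
          exact h2
        rw [lt_div_iff₀ hy0] at h1
        rw [Real.rpow_neg hs.le, ← div_eq_inv_mul, lt_div_iff₀ (Real.rpow_pos_of_pos hs _)]
        linarith [mul_comm ((-τ) ^ γ) ‖y‖]
      rw [hg]
      simp only [indicator_of_mem (show (τ, y) ∈ {z : ℝ × EuclideanSpace ℝ (Fin 3) |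
        ‖z.2‖ < (-z.1) ^ (-γ) * a} from hlt)]
    calc ENNReal.ofReal (a ^ (1 - ρ) / κ) * w y
        = ENNReal.ofReal (m ^ (3 * γ - 2 + 1) / (3 * γ - 2 + 1)) *
            ENNReal.ofReal (frobeniusNormSq (G y)) := by
          rw [hw]
          simp only
          rw [mul_comm (ENNReal.ofReal (frobeniusNormSq (G y))), ← mul_assoc,
            ← ENNReal.ofReal_mul (by positivity)]
          congr 2
          have hmk : m ^ (3 * γ - 2 + 1) = a ^ (1 - ρ) * ‖y‖ ^ (ρ - 1) := by
            rw [hm, ← Real.rpow_mul (div_pos ha hy0).le,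
              show (2 + ρ) * (3 * γ - 2 + 1) = 1 - ρ by linear_combination 3 * hγρ,
              Real.div_rpow ha.le hy0.le, div_eq_mul_inv, ← Real.rpow_neg hy0.le]
            congr 2; ring
          rw [hmk, show (3 * γ - 2 + 1 : ℝ) = κ by rw [hκdef]; ring]
          ring
      _ = ∫⁻ τ in Ioo (-m) 0, ENNReal.ofReal ((-τ) ^ (3 * γ - 2)) *
            ENNReal.ofReal (frobeniusNormSq (G y)) := by
          rw [lintegral_mul_const' _ _ ENNReal.ofReal_ne_top, lintegral_Ioo_neg_rpow hq hm0]
      _ = ∫⁻ τ in Ioo (-m) 0, g τ y := (setLIntegral_congr_fun measurableSet_Ioo hind).symm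
      _ ≤ ∫⁻ τ in Ioo (-Λ) 0, g τ y :=
          lintegral_mono_set (Ioo_subset_Ioo (by linarith) le_rfl)
  -- (1e) assemble
  have hmeasR : MeasurableSet {y : EuclideanSpace ℝ (Fin 3) | a * Λ ^ (-γ) ≤ ‖y‖} :=
    measurableSet_le measurable_const measurable_norm
  rw [← lintegral_const_mul' _ _ ENNReal.ofReal_ne_top, hXswap, ← lintegral_indicator hmeasR]
  refine lintegral_mono fun y => ?_
  by_cases hy : y ∈ {y : EuclideanSpace ℝ (Fin 3) | a * Λ ^ (-γ) ≤ ‖y‖}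
  · rw [indicator_of_mem hy]; exact hlow y hy
  · rw [indicator_of_notMem hy]; exact zero_le

/-- **WEIGHTED DISSIPATION OFF A BALL FROM THE `E`-GAUGE, FOR A MEMBER EXACT UP TO ITS BLOW-UP TIME.**  `H` a.e.-strongly measurable
on the slab with `H τ = (T − τ)^{−1} • G((T − τ)^{−γ}(· − x₀))` a.e. for a.e. `τ < T` (`T ≤ 0`, `γ = 1/(2+ρ)`, `0 < ρ < 1`), power
gauge `A^{ρ} E(A; 0; H) ≤ c` for all `A > 0`.  Then for every `a > 0`, with `A = a + ‖x₀‖ + √(−T) + 1` and `Λ = A² + T (≥ 1)`: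
`∫_{‖y‖ ≥ aΛ^{−γ}} |G|²_F ‖y‖^{ρ−1} ≤ ((1−ρ)/(2+ρ)) (A/a)^{1−ρ} c`.  (Translate by `(T, x₀)`: the window `(−Λ,0) × B_a` translates into
`Q_A(0,0)`; then `lintegral_weight_region_le_cylinder`.) [folklore] -/
theorem lintegral_weight_region_le_of_gaugeE_blowup {ρ T : ℝ} (hρ : 0 < ρ) (hρ1 : ρ < 1) (hT : T ≤ 0)
    (x₀ : EuclideanSpace ℝ (Fin 3))
    {H : ℝ → EuclideanSpace ℝ (Fin 3) → EuclideanSpace ℝ (Fin 3) →L[ℝ] EuclideanSpace ℝ (Fin 3)}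
    {G : EuclideanSpace ℝ (Fin 3) → EuclideanSpace ℝ (Fin 3) →L[ℝ] EuclideanSpace ℝ (Fin 3)} {c : ℝ≥0}
    (hHm : AEStronglyMeasurable (uncurry H)
      (volume.restrict (Iio (0 : ℝ) ×ˢ (univ : Set (EuclideanSpace ℝ (Fin 3))))))
    (hGm : AEStronglyMeasurable G volume)
    (hH : ∀ᵐ τ ∂((volume : Measure ℝ).restrict (Iio T)),
      H τ =ᵐ[volume] fun x => (T - τ) ^ (-1 : ℝ) • G ((T - τ) ^ (-(1 / (2 + ρ))) • (x - x₀)))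
    (hE : ∀ A : ℝ, 0 < A →
      ENNReal.ofReal (A ^ ρ) * cknE A (0 : ℝ × EuclideanSpace ℝ (Fin 3)) H ≤ (c : ℝ≥0∞))
    {a : ℝ} (ha : 0 < a) :
    ∫⁻ y in {y : EuclideanSpace ℝ (Fin 3) |
        a * ((a + ‖x₀‖ + Real.sqrt (-T) + 1) ^ 2 + T) ^ (-(1 / (2 + ρ))) ≤ ‖y‖},
        ENNReal.ofReal (frobeniusNormSq (G y)) * ENNReal.ofReal (‖y‖ ^ (ρ - 1)) ≤
      ENNReal.ofReal ((1 - ρ) / (2 + ρ) / a ^ (1 - ρ) * (a + ‖x₀‖ + Real.sqrt (-T) + 1) ^ (1 - ρ)) *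
        (c : ℝ≥0∞) := by
  set A : ℝ := a + ‖x₀‖ + Real.sqrt (-T) + 1 with hA
  have hs0 : 0 ≤ Real.sqrt (-T) := Real.sqrt_nonneg _
  have hsT : Real.sqrt (-T) ^ 2 = -T := Real.sq_sqrt (by linarith)
  have hA0 : 0 < A := by rw [hA]; linarith [norm_nonneg x₀]
  set Λ : ℝ := A ^ 2 + T with hΛdef
  have hΛ : 0 < Λ := by rw [hΛdef, hA]; nlinarith [norm_nonneg x₀]
  have h1ρ : 0 < 1 - ρ := by linarith
  have h2ρ : 0 < 2 + ρ := by linarith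
  -- ### (1) the gauge at scale `A`: `X = ∫∫_{Q_A} |H|²_F ≤ A^{1−ρ} c`
  set X : ℝ≥0∞ := ∫⁻ q in parabolicCylinder A (0 : ℝ × EuclideanSpace ℝ (Fin 3)),
    ENNReal.ofReal (frobeniusNormSq (H q.1 q.2)) with hX
  have hXle : X ≤ ENNReal.ofReal (A ^ (1 - ρ)) * (c : ℝ≥0∞) := by
    have h1 := hE A hA0
    unfold cknE at h1
    have hB0 : ENNReal.ofReal (A ^ ρ) ≠ 0 := by
      rw [ENNReal.ofReal_ne_zero_iff]; exact Real.rpow_pos_of_pos hA0 _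
    have hA0' : ENNReal.ofReal A ≠ 0 := by rw [ENNReal.ofReal_ne_zero_iff]; exact hA0
    have key : X = ENNReal.ofReal A * (ENNReal.ofReal (A ^ ρ))⁻¹ *
        (ENNReal.ofReal (A ^ ρ) * ((ENNReal.ofReal A)⁻¹ * X)) := by
      rw [← mul_assoc, mul_assoc (ENNReal.ofReal A), ENNReal.inv_mul_cancel hB0 ENNReal.ofReal_ne_top,
        mul_one, ← mul_assoc, ENNReal.mul_inv_cancel hA0' ENNReal.ofReal_ne_top, one_mul]
    calc X = _ := key
      _ ≤ ENNReal.ofReal A * (ENNReal.ofReal (A ^ ρ))⁻¹ * (c : ℝ≥0∞) := by gcongr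
      _ = ENNReal.ofReal (A ^ (1 - ρ)) * (c : ℝ≥0∞) := by
          rw [← ENNReal.ofReal_inv_of_pos (Real.rpow_pos_of_pos hA0 _), ← ENNReal.ofReal_mul hA0.le]
          congr 2
          rw [Real.rpow_sub hA0, Real.rpow_one, div_eq_mul_inv]
  -- ### (2) translation by `(T, x₀)`
  set Ht : ℝ → EuclideanSpace ℝ (Fin 3) → EuclideanSpace ℝ (Fin 3) →L[ℝ] EuclideanSpace ℝ (Fin 3) :=
    fun τ x => H (τ + T) (x + x₀) with hHt
  haveI : (volume : Measure (ℝ × EuclideanSpace ℝ (Fin 3))).IsAddRightInvariant := by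
    rw [Measure.volume_eq_prod]; infer_instance
  have hg : MeasurePreserving (fun z : ℝ × EuclideanSpace ℝ (Fin 3) => z + (T, x₀)) volume volume :=
    measurePreserving_add_right volume (T, x₀)
  have hge : MeasurableEmbedding (fun z : ℝ × EuclideanSpace ℝ (Fin 3) => z + (T, x₀)) :=
    measurableEmbedding_addRight (T, x₀)
  have hsubQ : Ioo (-Λ) 0 ×ˢ ball (0 : EuclideanSpace ℝ (Fin 3)) a ⊆
      (fun z : ℝ × EuclideanSpace ℝ (Fin 3) => z + (T, x₀)) ⁻¹'
        parabolicCylinder A (0 : ℝ × EuclideanSpace ℝ (Fin 3)) := by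
    rintro ⟨τ, x⟩ ⟨hτ, hx⟩
    rw [mem_ball, dist_zero_right] at hx
    simp only [parabolicCylinder, mem_preimage, Prod.mk_add_mk, Prod.fst_zero, Prod.snd_zero, zero_sub,
      mem_prod, mem_Ioo, mem_ball, dist_zero_right]
    refine ⟨⟨by rw [hΛdef] at hτ; linarith [hτ.1], by linarith [hτ.2]⟩, ?_⟩
    exact (norm_add_le _ _).trans_lt (by rw [hA]; linarith)
  have hsubS : Ioo (-Λ) 0 ×ˢ ball (0 : EuclideanSpace ℝ (Fin 3)) a ⊆
      (fun z : ℝ × EuclideanSpace ℝ (Fin 3) => z + (T, x₀)) ⁻¹'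
        (Iio (0 : ℝ) ×ˢ (univ : Set (EuclideanSpace ℝ (Fin 3)))) := by
    rintro ⟨τ, x⟩ ⟨hτ, -⟩
    simp only [mem_preimage, Prod.mk_add_mk, mem_prod, mem_Iio, mem_univ, and_true]
    linarith [hτ.2]
  -- the translated window integral is at most the cylinder integral
  have hX' : ∫⁻ q in Ioo (-Λ) 0 ×ˢ ball (0 : EuclideanSpace ℝ (Fin 3)) a,
      ENNReal.ofReal (frobeniusNormSq (Ht q.1 q.2)) ≤ X := by
    have e := hg.setLIntegral_comp_preimage_emb hge
      (fun q : ℝ × EuclideanSpace ℝ (Fin 3) => ENNReal.ofReal (frobeniusNormSq (H q.1 q.2)))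
      (parabolicCylinder A (0 : ℝ × EuclideanSpace ℝ (Fin 3)))
    rw [hX, ← e]
    exact lintegral_mono_set hsubQ
  -- measurability of the translate on the window
  have hHtm : AEStronglyMeasurable (uncurry Ht)
      (volume.restrict (Ioo (-Λ) 0 ×ˢ ball (0 : EuclideanSpace ℝ (Fin 3)) a)) := by
    have h1 := hg.restrict_preimage_emb hge (Iio (0 : ℝ) ×ˢ (univ : Set (EuclideanSpace ℝ (Fin 3))))
    have h2 := hHm.comp_measurePreserving h1
    rw [show uncurry Ht = uncurry H ∘ fun z : ℝ × EuclideanSpace ℝ (Fin 3) => z + (T, x₀) from funext fun _ => rfl]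
    exact h2.mono_measure (Measure.restrict_mono hsubS le_rfl)
  -- the a.e. centred self-similar form of the translate
  have hHt_ae : ∀ᵐ τ ∂((volume : Measure ℝ).restrict (Ioo (-Λ) 0)),
      Ht τ =ᵐ[volume] fun x => (-τ) ^ (-1 : ℝ) • G ((-τ) ^ (-(1 / (2 + ρ))) • x) := by
    have hφ : MeasurePreserving (fun τ : ℝ => τ + T) volume volume := measurePreserving_add_right volume T
    have hφe : MeasurableEmbedding (fun τ : ℝ => τ + T) := measurableEmbedding_addRight T
    have h1 := hφ.restrict_preimage_emb hφe (Iio T)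
    rw [show (fun τ : ℝ => τ + T) ⁻¹' Iio T = Iio 0 by ext τ; simp] at h1
    have h2 : ∀ᵐ τ ∂((volume : Measure ℝ).restrict (Iio 0)),
        H (τ + T) =ᵐ[volume] fun x =>
          (T - (τ + T)) ^ (-1 : ℝ) • G ((T - (τ + T)) ^ (-(1 / (2 + ρ))) • (x - x₀)) :=
      h1.quasiMeasurePreserving.tendsto_ae.eventually hH
    have h3 : ∀ᵐ τ ∂((volume : Measure ℝ).restrict (Ioo (-Λ) 0)),
        H (τ + T) =ᵐ[volume] fun x =>
          (T - (τ + T)) ^ (-1 : ℝ) • G ((T - (τ + T)) ^ (-(1 / (2 + ρ))) • (x - x₀)) :=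
      ae_restrict_of_ae_restrict_of_subset (fun τ hτ => hτ.2) h2
    filter_upwards [h3] with τ hτ
    have hψ : Measure.QuasiMeasurePreserving (fun x : EuclideanSpace ℝ (Fin 3) => x + x₀) volume volume :=
      (measurePreserving_add_right volume x₀).quasiMeasurePreserving
    have h4 := hψ.ae_eq_comp hτ
    rw [show Ht τ = H (τ + T) ∘ fun x : EuclideanSpace ℝ (Fin 3) => x + x₀ from funext fun _ => rfl]
    refine h4.trans (Eventually.of_forall fun x => ?_)
    simp only [comp_apply, add_sub_cancel_right, show T - (τ + T) = -τ by ring]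
  -- ### (3) the centred single-window bound, and division by the constant
  have hB := lintegral_weight_region_le_cylinder hρ hρ1 hΛ ha hGm hHtm hHt_ae
  have h2 := (hB.trans hX').trans hXle
  have hkpos : 0 < a ^ (1 - ρ) / ((1 - ρ) / (2 + ρ)) :=
    div_pos (Real.rpow_pos_of_pos ha _) (div_pos h1ρ h2ρ)
  have hne : ENNReal.ofReal (a ^ (1 - ρ) / ((1 - ρ) / (2 + ρ))) ≠ 0 := by
    rw [ENNReal.ofReal_ne_zero_iff]; exact hkpos
  calc ∫⁻ y in {y : EuclideanSpace ℝ (Fin 3) | a * Λ ^ (-(1 / (2 + ρ))) ≤ ‖y‖},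
          ENNReal.ofReal (frobeniusNormSq (G y)) * ENNReal.ofReal (‖y‖ ^ (ρ - 1))
      = (ENNReal.ofReal (a ^ (1 - ρ) / ((1 - ρ) / (2 + ρ))))⁻¹ *
          (ENNReal.ofReal (a ^ (1 - ρ) / ((1 - ρ) / (2 + ρ))) *
            ∫⁻ y in {y : EuclideanSpace ℝ (Fin 3) | a * Λ ^ (-(1 / (2 + ρ))) ≤ ‖y‖},
              ENNReal.ofReal (frobeniusNormSq (G y)) * ENNReal.ofReal (‖y‖ ^ (ρ - 1))) := by
        rw [← mul_assoc, ENNReal.inv_mul_cancel hne ENNReal.ofReal_ne_top, one_mul]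
    _ ≤ (ENNReal.ofReal (a ^ (1 - ρ) / ((1 - ρ) / (2 + ρ))))⁻¹ *
          (ENNReal.ofReal (A ^ (1 - ρ)) * (c : ℝ≥0∞)) := by gcongr
    _ = ENNReal.ofReal ((1 - ρ) / (2 + ρ) / a ^ (1 - ρ) * A ^ (1 - ρ)) * (c : ℝ≥0∞) := by
        rw [← mul_assoc, ← ENNReal.ofReal_inv_of_pos hkpos,
          ← ENNReal.ofReal_mul (by positivity)]
        congr 2
        field_simp

/-- **FINITE WEIGHTED DISSIPATION INTEGRAL OF A `C¹` PROFILE, MEMBER EXACT UP TO ITS BLOW-UP TIME.**  `u(τ, x) =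
(T−τ)^{γ−1} V((T−τ)^{−γ}(x − x₀))` for all `τ < T` (`T ≤ 0`, `γ = 1/(2+ρ)`, `0 < ρ < 1`), `H` a weak spatial gradient of `u` on the
slab with `A^ρ E(A; 0; H) ≤ c`, `V ∈ C¹` ⇒ `∫⁻ ‖DV‖ₑ² ‖y‖^{ρ−1} ≤ E` for some real `E` — the hypothesis `hEw` of
`Condenser.selfSimilar_ae_eq_zero_of_finiteTypeGradientC2_past_of_weight` (off the ball `‖y‖ < Λ^{−γ}` by
`lintegral_weight_region_le_of_gaugeE_blowup` at `a = 1`, `G = DV` a.e.; on it `DV` is bounded and `‖y‖^{ρ−1}` integrable). [folklore] -/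
theorem exists_lintegral_weightedGradient_le_of_blowup {ρ T : ℝ} (hρ : 0 < ρ) (hρ1 : ρ < 1) (hT : T ≤ 0)
    (x₀ : EuclideanSpace ℝ (Fin 3))
    {u : ℝ → EuclideanSpace ℝ (Fin 3) → EuclideanSpace ℝ (Fin 3)}
    {H : ℝ → EuclideanSpace ℝ (Fin 3) → EuclideanSpace ℝ (Fin 3) →L[ℝ] EuclideanSpace ℝ (Fin 3)} {c : ℝ≥0}
    (hH : HasWeakSpatialGradientOn (slab (EuclideanSpace ℝ (Fin 3)) (Iio 0) isOpen_Iio) u H)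
    {V : EuclideanSpace ℝ (Fin 3) → EuclideanSpace ℝ (Fin 3)}
    (hu : ∀ τ : ℝ, τ < T → u τ = fun x => selfSimilarCollapse (1 / (2 + ρ)) T V τ (x - x₀))
    (hE : ∀ A : ℝ, 0 < A →
      ENNReal.ofReal (A ^ ρ) * cknE A (0 : ℝ × EuclideanSpace ℝ (Fin 3)) H ≤ (c : ℝ≥0∞))
    (hV : ContDiff ℝ 1 V) :
    ∃ E : ℝ, ∫⁻ y, ‖fderiv ℝ V y‖ₑ ^ 2 * ENNReal.ofReal (‖y‖ ^ (ρ - 1)) ≤ ENNReal.ofReal E := by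
  obtain ⟨G, hGm, hVG, hae⟩ := exists_profileGradient_ae_of_past hH hT le_rfl x₀ hu
  have hHm : AEStronglyMeasurable (uncurry H)
      (volume.restrict (Iio (0 : ℝ) ×ˢ (univ : Set (EuclideanSpace ℝ (Fin 3))))) := by
    have := hH.locallyIntegrableOn_grad.aestronglyMeasurable
    simpa [slab] using this
  -- the weak gradient of a `C¹` map is its classical derivative, a.e.
  have hGfd : G =ᵐ[volume] fderiv ℝ V := by
    have h := HasWeakFDerivOn.unique_holds hVG (HasWeakFDerivOn.of_contDiff_holds ⊤ volume hV)
    rwa [TopologicalSpace.Opens.coe_top, Measure.restrict_univ] at h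
  -- off the ball: the gauge at one scale
  have hreg := lintegral_weight_region_le_of_gaugeE_blowup hρ hρ1 hT x₀ hHm hGm hae hE one_pos
  set r : ℝ := 1 * ((1 + ‖x₀‖ + Real.sqrt (-T) + 1) ^ 2 + T) ^ (-(1 / (2 + ρ))) with hr
  have hΛ : 0 < (1 + ‖x₀‖ + Real.sqrt (-T) + 1) ^ 2 + T := by
    have hsT : Real.sqrt (-T) ^ 2 = -T := Real.sq_sqrt (by linarith)
    nlinarith [Real.sqrt_nonneg (-T), norm_nonneg x₀]
  have hr0 : 0 < r := by rw [hr, one_mul]; exact Real.rpow_pos_of_pos hΛ _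
  set R : Set (EuclideanSpace ℝ (Fin 3)) := {y | r ≤ ‖y‖} with hR
  have hRm : MeasurableSet R := measurableSet_le measurable_const measurable_norm
  set f : EuclideanSpace ℝ (Fin 3) → ℝ≥0∞ :=
    fun y => ‖fderiv ℝ V y‖ₑ ^ 2 * ENNReal.ofReal (‖y‖ ^ (ρ - 1)) with hf
  -- pointwise comparison with the Frobenius weight of `G`, a.e.
  have hfle : f ≤ᵐ[volume] fun y => ENNReal.ofReal (frobeniusNormSq (G y)) * ENNReal.ofReal (‖y‖ ^ (ρ - 1)) := by
    filter_upwards [hGfd] with y hy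
    rw [hf, hy]
    have e1 : ‖fderiv ℝ V y‖ₑ ^ 2 = ENNReal.ofReal (‖fderiv ℝ V y‖ ^ 2) := by
      rw [← ofReal_norm, ENNReal.ofReal_pow (norm_nonneg _)]
    simp only
    rw [e1]
    exact mul_le_mul_left (ENNReal.ofReal_le_ofReal (norm_sq_le_frobeniusNormSq _)) _
  have hIR : ∫⁻ y in R, f y ≤
      ENNReal.ofReal ((1 - ρ) / (2 + ρ) / (1 : ℝ) ^ (1 - ρ) * (1 + ‖x₀‖ + Real.sqrt (-T) + 1) ^ (1 - ρ)) *
        (c : ℝ≥0∞) :=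
    (lintegral_mono_ae (ae_restrict_of_ae hfle)).trans hreg
  -- on the ball: `DV` bounded, `‖y‖^{ρ−1}` integrable
  obtain ⟨M, hM⟩ := (isCompact_closedBall (0 : EuclideanSpace ℝ (Fin 3)) r).exists_bound_of_continuousOn
    ((hV.continuous_fderiv one_ne_zero).continuousOn)
  have hM0 : 0 ≤ M := (norm_nonneg _).trans (hM 0 (mem_closedBall_self hr0.le))
  have hRc : Rᶜ = ball (0 : EuclideanSpace ℝ (Fin 3)) r := by
    ext y; simp [hR, not_le]
  have hIB : ∫⁻ y in Rᶜ, f y ≤ ENNReal.ofReal (M ^ 2) *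
      ENNReal.ofReal (3 * (volume : Measure (EuclideanSpace ℝ (Fin 3))).real (ball 0 1) *
        (r ^ (3 - (1 - ρ)) / (3 - (1 - ρ)))) := by
    rw [hRc, ← NewtonPotentialHolder.lintegral_ball_norm_rpow_neg (by linarith) hr0,
      ← lintegral_const_mul' _ _ ENNReal.ofReal_ne_top]
    refine setLIntegral_mono' measurableSet_ball fun y hy => ?_
    rw [hf]
    simp only
    rw [show (-(1 - ρ) : ℝ) = ρ - 1 by ring]
    refine mul_le_mul_left ?_ _
    have e1 : ‖fderiv ℝ V y‖ₑ ^ 2 = ENNReal.ofReal (‖fderiv ℝ V y‖ ^ 2) := by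
      rw [← ofReal_norm, ENNReal.ofReal_pow (norm_nonneg _)]
    rw [e1]
    refine ENNReal.ofReal_le_ofReal ?_
    have := hM y (ball_subset_closedBall hy)
    nlinarith [norm_nonneg (fderiv ℝ V y)]
  -- assemble
  set Tot : ℝ≥0∞ := ENNReal.ofReal ((1 - ρ) / (2 + ρ) / (1 : ℝ) ^ (1 - ρ) *
      (1 + ‖x₀‖ + Real.sqrt (-T) + 1) ^ (1 - ρ)) * (c : ℝ≥0∞) +
    ENNReal.ofReal (M ^ 2) *
      ENNReal.ofReal (3 * (volume : Measure (EuclideanSpace ℝ (Fin 3))).real (ball 0 1) *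
        (r ^ (3 - (1 - ρ)) / (3 - (1 - ρ)))) with hTot
  have hTot_ne : Tot ≠ ⊤ :=
    ENNReal.add_ne_top.2 ⟨ENNReal.mul_ne_top ENNReal.ofReal_ne_top ENNReal.coe_ne_top,
      ENNReal.mul_ne_top ENNReal.ofReal_ne_top ENNReal.ofReal_ne_top⟩
  refine ⟨Tot.toReal, ?_⟩
  rw [ENNReal.ofReal_toReal hTot_ne, ← lintegral_add_compl f hRm]
  exact add_le_add hIR hIB

end Past

end Summit.NavierStokesRegularity.NavierStokesRegularity.Theorems.PowerGaugeEulerLiouville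

end
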